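import Summits.RiemannHypothesis.RiemannHypothesis.Theorems.Splittings.RobinFiniteCakeTail

/-!
# RobinFiniteCakePeel — gen 19 «LAYER CAKE AT PT», part 2/10 (B): the reflected charge `chargeA x u = (x^u + x^{-u})/2`, the layered functional `cakePhi`, the class masses `cakeMass`, the Abel peel over a stair of cuts (`cakePhi_peel_window`) and the window start `offLine_le_start_window`: `OFF(T,x) ≤ (X^{u₁}+1)/2·tailH(T) + cakePhi`. RH-free; `def`s `chargeA`, `cakePhi`, `cakeMass`.

Cell rh-split, seat rh-split-robin-finite g19 (card `cards/SPLIT-robin-finite.md` §26); carved VERBATIM from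
`HOME/rh-split-robin-finite/g19/SketchG19.lean` (sha16 c333eb23d46ea866) by `mk_carve.py`.  Nothing here bears on the truth of RH.

HONEST LABEL: SPLITTING SEARCH over kernel-typed RH-EQUIVALENCES; a splitting A ∧ B ⟹ RH is CONDITIONAL
bookkeeping unless A and B are both proved; nothing here bears on the truth of RH.
-/

set_option linter.dupNamespace false

noncomputable section

open Real Filter Finset
open scoped Chebyshev ComplexConjugate

namespace Summit.RiemannHypothesis.RiemannHypothesis.Theorems.Splittings.RobinFiniteC1

open Literature.NumberTheory.LFunctions Literature.NumberTheory.DiophantineGeometry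
open Literature.NumberTheory.LFunctions.SchoenfeldBound
open Literature.NumberTheory.LFunctions.NicolasJExplicit
open RobinAnalyticSharp
open Literature.NumberTheory.LFunctions.VdC.Num (rpow_le_of_pow_le le_rpow_of_pow_le)
open Summit.RiemannHypothesis.RiemannHypothesis.Theorems.Splittings.RobinFiniteE3
open Summit.RiemannHypothesis.RiemannHypothesis.Theorems.Splittings.RobinFiniteTail
  (zeroTailBound_tailH tailH_PT_le tailH_nonneg)
open Summit.RiemannHypothesis.RiemannHypothesis.Theorems.Splittings.RobinFiniteE1c (summable_tailTerm)

section CakeB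

/-! ### C2 · the even charge `a_x(u) = (x^u + x^{−u})/2` -/

/-- The even charge `a_x(u) = (x^u + x^{−u})/2 = cosh(u·log x)`. -/
def chargeA (x u : ℝ) : ℝ := (x ^ u + x ^ (-u)) / 2

/-- The charge is non-negative. -/
theorem chargeA_nonneg {x : ℝ} (hx : 0 ≤ x) (u : ℝ) : 0 ≤ chargeA x u := by
  unfold chargeA; positivity

/-- `a_x` is even: `a_x(|u|) = a_x(u)`. -/
theorem chargeA_abs (x u : ℝ) : chargeA x |u| = chargeA x u := by
  unfold chargeA
  rcases le_or_gt 0 u with h | h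
  · rw [abs_of_nonneg h]
  · rw [abs_of_neg h, neg_neg, add_comm]

/-- `a_x` is nondecreasing in `|u|` for `x ≥ 1` (tree `rpow_add_rpow_neg_le`). -/
theorem chargeA_mono {x u v : ℝ} (hx : 1 ≤ x) (h : |u| ≤ v) : chargeA x u ≤ chargeA x v := by
  unfold chargeA
  have := rpow_add_rpow_neg_le hx h
  linarith

/-- `a_x(½) = (√x + 1/√x)/2` and every zero's charge is at most it: `a_x(β − ½) ≤ a_x(½)` (`0 < β < 1`). -/
theorem chargeA_zero_le_half {x : ℝ} (hx : 1 ≤ x) (ρ : RHWave0.riemannZetaNontrivialZeros) :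
    chargeA x ((ρ : ℂ).re - 1 / 2) ≤ chargeA x (1 / 2) := by
  have hre0 := ZetaZeros.riemannZetaNontrivialZeros.re_pos ρ.2
  have hre1 := ZetaZeros.riemannZetaNontrivialZeros.re_lt_one ρ.2
  exact chargeA_mono hx (abs_le.2 ⟨by linarith, by linarith⟩)

/-- Window form of the charge increments: for `1 ≤ x ≤ X` and `0 ≤ u ≤ v`, `a_x(v) − a_x(u) ≤ (X^v − X^u)/2`
(`x^{−v} ≤ x^{−u}`; `x^v − x^u = x^u·(x^{v−u} − 1)` is a product of nonnegative nondecreasing factors). -/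
theorem chargeA_sub_le {x X u v : ℝ} (hx : 1 ≤ x) (hxX : x ≤ X) (hu : 0 ≤ u) (huv : u ≤ v) :
    chargeA x v - chargeA x u ≤ (X ^ v - X ^ u) / 2 := by
  have hx0 : 0 < x := by linarith
  have hX1 : 1 ≤ X := hx.trans hxX
  have hX0 : 0 < X := by linarith
  have hneg : x ^ (-v) ≤ x ^ (-u) := Real.rpow_le_rpow_of_exponent_le hx (by linarith)
  have hxu : x ^ u ≤ X ^ u := Real.rpow_le_rpow hx0.le hxX hu
  have hd0 : 0 ≤ x ^ (v - u) - 1 := by linarith [Real.one_le_rpow hx (by linarith : 0 ≤ v - u)]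
  have hd : x ^ (v - u) - 1 ≤ X ^ (v - u) - 1 := by
    linarith [Real.rpow_le_rpow hx0.le hxX (by linarith : 0 ≤ v - u)]
  have hXu0 : 0 ≤ X ^ u := Real.rpow_nonneg hX0.le u
  have key : x ^ v - x ^ u ≤ X ^ v - X ^ u := by
    have e1 : x ^ v - x ^ u = x ^ u * (x ^ (v - u) - 1) := by
      rw [mul_sub, ← Real.rpow_add hx0, mul_one]; ring_nf
    have e2 : X ^ v - X ^ u = X ^ u * (X ^ (v - u) - 1) := by
      rw [mul_sub, ← Real.rpow_add hX0, mul_one]; ring_nf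
    rw [e1, e2]
    exact mul_le_mul hxu hd hd0 hXu0
  unfold chargeA
  linarith

/-- Window form of the base charge: for `1 ≤ x ≤ X` and `0 ≤ u`, `a_x(u) ≤ (X^u + 1)/2`. -/
theorem chargeA_le_window {x X u : ℝ} (hx : 1 ≤ x) (hxX : x ≤ X) (hu : 0 ≤ u) :
    chargeA x u ≤ (X ^ u + 1) / 2 := by
  have hx0 : 0 < x := by linarith
  have h1 : x ^ u ≤ X ^ u := Real.rpow_le_rpow hx0.le hxX hu
  have h2 : x ^ (-u) ≤ 1 := Real.rpow_le_one_of_one_le_of_nonpos hx (by linarith)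
  unfold chargeA
  linarith

/-! ### C3 · the excess functional `Φ(u)` and the class mass `M(u)`; START / PEEL / END -/

/-- The excess charge of the class `|β − ½| ≥ u` beyond height `T`:
`Φ_{T,x}(u) = Σ_{|γ|>T, |β−½| ≥ u} m(ρ)·(a_x(β − ½) − a_x(u))/γ²`. -/
def cakePhi (T x u : ℝ) : ℝ :=
  ∑' ρ : RHWave0.riemannZetaNontrivialZeros,
    (if T < |(ρ : ℂ).im| ∧ u ≤ |(ρ : ℂ).re - 1 / 2| then
      (riemannZetaZeroOrder (ρ : ℂ) : ℝ) / (ρ : ℂ).im ^ 2 * (chargeA x ((ρ : ℂ).re - 1 / 2) - chargeA x u) else 0)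

/-- The mass of the class `|β − ½| ≥ u` beyond height `T`: `M_T(u) = Σ_{|γ|>T, |β−½| ≥ u} m(ρ)/γ²`. -/
def cakeMass (T u : ℝ) : ℝ :=
  ∑' ρ : RHWave0.riemannZetaNontrivialZeros,
    (if T < |(ρ : ℂ).im| ∧ u ≤ |(ρ : ℂ).re - 1 / 2| then (riemannZetaZeroOrder (ρ : ℂ) : ℝ) / (ρ : ℂ).im ^ 2 else 0)

/-- The `Φ`-summand is nonnegative (`a_x` is nondecreasing in `|·|`) and dominated by `a_x(½)·m/γ²`. -/
theorem cakePhi_term_bounds {T x u : ℝ} (hx : 1 ≤ x) (hu : 0 ≤ u) (ρ : RHWave0.riemannZetaNontrivialZeros) :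
    0 ≤ (if T < |(ρ : ℂ).im| ∧ u ≤ |(ρ : ℂ).re - 1 / 2| then
        (riemannZetaZeroOrder (ρ : ℂ) : ℝ) / (ρ : ℂ).im ^ 2 * (chargeA x ((ρ : ℂ).re - 1 / 2) - chargeA x u) else 0) ∧
      (if T < |(ρ : ℂ).im| ∧ u ≤ |(ρ : ℂ).re - 1 / 2| then
        (riemannZetaZeroOrder (ρ : ℂ) : ℝ) / (ρ : ℂ).im ^ 2 * (chargeA x ((ρ : ℂ).re - 1 / 2) - chargeA x u) else 0) ≤
        chargeA x (1 / 2) *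
          (if T < |(ρ : ℂ).im| then (riemannZetaZeroOrder (ρ : ℂ) : ℝ) / (ρ : ℂ).im ^ 2 else 0) := by
  have hw : 0 ≤ (riemannZetaZeroOrder (ρ : ℂ) : ℝ) / (ρ : ℂ).im ^ 2 := div_nonneg (zeroOrder_nonneg' ρ) (sq_nonneg _)
  have htop := chargeA_zero_le_half hx ρ
  have hA0 := chargeA_nonneg (by linarith : (0 : ℝ) ≤ x) u
  by_cases h : T < |(ρ : ℂ).im| ∧ u ≤ |(ρ : ℂ).re - 1 / 2|
  · rw [if_pos h, if_pos h.1]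
    have hmono : chargeA x u ≤ chargeA x ((ρ : ℂ).re - 1 / 2) := by
      rw [← chargeA_abs x ((ρ : ℂ).re - 1 / 2)]
      exact chargeA_mono hx (by rw [abs_of_nonneg hu]; exact h.2)
    refine ⟨mul_nonneg hw (by linarith), ?_⟩
    rw [mul_comm]
    exact mul_le_mul_of_nonneg_right (by linarith) hw
  · rw [if_neg h]
    refine ⟨le_rfl, mul_nonneg (chargeA_nonneg (by linarith) _) ?_⟩
    split_ifs
    · exact hw
    · exact le_rfl

/-- The `Φ`-series is summable (dominated by `a_x(½)·Σ m/γ²`). -/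
theorem summable_cakePhi {T x u : ℝ} (hx : 1 ≤ x) (hu : 0 ≤ u) :
    Summable fun ρ : RHWave0.riemannZetaNontrivialZeros =>
      (if T < |(ρ : ℂ).im| ∧ u ≤ |(ρ : ℂ).re - 1 / 2| then
        (riemannZetaZeroOrder (ρ : ℂ) : ℝ) / (ρ : ℂ).im ^ 2 * (chargeA x ((ρ : ℂ).re - 1 / 2) - chargeA x u) else 0) :=
  ((summable_tailTerm T).mul_left (chargeA x (1 / 2))).of_nonneg_of_le
    (fun ρ => (cakePhi_term_bounds hx hu ρ).1) (fun ρ => (cakePhi_term_bounds hx hu ρ).2)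

/-- The class-mass summand lies between `0` and `m/γ²`. -/
theorem cakeMass_term_bounds (T u : ℝ) (ρ : RHWave0.riemannZetaNontrivialZeros) :
    0 ≤ (if T < |(ρ : ℂ).im| ∧ u ≤ |(ρ : ℂ).re - 1 / 2| then (riemannZetaZeroOrder (ρ : ℂ) : ℝ) / (ρ : ℂ).im ^ 2 else 0) ∧
      (if T < |(ρ : ℂ).im| ∧ u ≤ |(ρ : ℂ).re - 1 / 2| then (riemannZetaZeroOrder (ρ : ℂ) : ℝ) / (ρ : ℂ).im ^ 2 else 0) ≤
        (if T < |(ρ : ℂ).im| then (riemannZetaZeroOrder (ρ : ℂ) : ℝ) / (ρ : ℂ).im ^ 2 else 0) := by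
  have hw : 0 ≤ (riemannZetaZeroOrder (ρ : ℂ) : ℝ) / (ρ : ℂ).im ^ 2 := div_nonneg (zeroOrder_nonneg' ρ) (sq_nonneg _)
  by_cases h : T < |(ρ : ℂ).im| ∧ u ≤ |(ρ : ℂ).re - 1 / 2|
  · rw [if_pos h, if_pos h.1]; exact ⟨hw, le_rfl⟩
  · rw [if_neg h]
    refine ⟨le_rfl, ?_⟩
    split_ifs
    · exact hw
    · exact le_rfl

/-- The class-mass series is summable (dominated by `Σ m/γ²`). -/
theorem summable_cakeMass (T u : ℝ) :
    Summable fun ρ : RHWave0.riemannZetaNontrivialZeros =>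
      (if T < |(ρ : ℂ).im| ∧ u ≤ |(ρ : ℂ).re - 1 / 2| then (riemannZetaZeroOrder (ρ : ℂ) : ℝ) / (ρ : ℂ).im ^ 2 else 0) :=
  (summable_tailTerm T).of_nonneg_of_le (fun ρ => (cakeMass_term_bounds T u ρ).1) (fun ρ => (cakeMass_term_bounds T u ρ).2)

/-- Class masses are non-negative. -/
theorem cakeMass_nonneg (T u : ℝ) : 0 ≤ cakeMass T u :=
  tsum_nonneg fun ρ => (cakeMass_term_bounds T u ρ).1

/-- `Φ` is non-negative for `x ≥ 1`, `u ≥ 0`. -/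
theorem cakePhi_nonneg {T x u : ℝ} (hx : 1 ≤ x) (hu : 0 ≤ u) : 0 ≤ cakePhi T x u :=
  tsum_nonneg fun ρ => (cakePhi_term_bounds (T := T) hx hu ρ).1

/-- **START.**  The reflected off-line sum is at most `a_x(u₁)·tail(T) + Φ(u₁)` for any first cut `u₁ ≥ 0`
(a zero with `|β−½| < u₁` pays `a_x(|β−½|) ≤ a_x(u₁)`; one with `|β−½| ≥ u₁` pays `a_x(u₁)` plus its excess). -/
theorem offLine_le_start {T x u₁ : ℝ} (hT : 7 ≤ T) (hx : 1 ≤ x) (hu₁ : 0 ≤ u₁) :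
    ∑' ρ : RHWave0.riemannZetaNontrivialZeros,
        (if T < |(ρ : ℂ).im| then
          (riemannZetaZeroOrder (ρ : ℂ) : ℝ) * x ^ ((ρ : ℂ).re - 1 / 2) / (ρ : ℂ).im ^ 2 else 0) ≤
      chargeA x u₁ * ((Real.log (T / (2 * π)) + 1) / (π * T) + (184 + 30 * Real.log T) / T ^ 2) + cakePhi T x u₁ := by
  rw [offLine_eq_tsum_symm T hx]
  set tail : RHWave0.riemannZetaNontrivialZeros → ℝ := fun ρ =>
    if T < |(ρ : ℂ).im| then (riemannZetaZeroOrder (ρ : ℂ) : ℝ) / (ρ : ℂ).im ^ 2 else 0 with htail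
  set phi : RHWave0.riemannZetaNontrivialZeros → ℝ := fun ρ =>
    (if T < |(ρ : ℂ).im| ∧ u₁ ≤ |(ρ : ℂ).re - 1 / 2| then
      (riemannZetaZeroOrder (ρ : ℂ) : ℝ) / (ρ : ℂ).im ^ 2 * (chargeA x ((ρ : ℂ).re - 1 / 2) - chargeA x u₁) else 0)
    with hphi
  have hStail : Summable tail := summable_tailTerm T
  have hSphi : Summable phi := summable_cakePhi hx hu₁
  have hA0 := chargeA_nonneg (by linarith : (0 : ℝ) ≤ x) u₁
  have hpt : ∀ ρ : RHWave0.riemannZetaNontrivialZeros,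
      (if T < |(ρ : ℂ).im| then
          (riemannZetaZeroOrder (ρ : ℂ) : ℝ) * ((x ^ ((ρ : ℂ).re - 1 / 2) + x ^ (-((ρ : ℂ).re - 1 / 2))) / 2) /
            (ρ : ℂ).im ^ 2 else 0) ≤ chargeA x u₁ * tail ρ + phi ρ := by
    intro ρ
    simp only [htail, hphi]
    have hw : 0 ≤ (riemannZetaZeroOrder (ρ : ℂ) : ℝ) / (ρ : ℂ).im ^ 2 :=
      div_nonneg (zeroOrder_nonneg' ρ) (sq_nonneg _)
    by_cases hTρ : T < |(ρ : ℂ).im|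
    · rw [if_pos hTρ, if_pos hTρ]
      have ec : (riemannZetaZeroOrder (ρ : ℂ) : ℝ) * ((x ^ ((ρ : ℂ).re - 1 / 2) + x ^ (-((ρ : ℂ).re - 1 / 2))) / 2) /
          (ρ : ℂ).im ^ 2 = chargeA x ((ρ : ℂ).re - 1 / 2) * ((riemannZetaZeroOrder (ρ : ℂ) : ℝ) / (ρ : ℂ).im ^ 2) := by
        unfold chargeA; ring
      rw [ec]
      by_cases hcl : u₁ ≤ |(ρ : ℂ).re - 1 / 2|
      · rw [if_pos ⟨hTρ, hcl⟩]; nlinarith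
      · rw [if_neg (fun h => hcl h.2), add_zero]
        rw [not_le] at hcl
        have hle : chargeA x ((ρ : ℂ).re - 1 / 2) ≤ chargeA x u₁ := chargeA_mono hx hcl.le
        exact mul_le_mul_of_nonneg_right hle hw
    · rw [if_neg hTρ, if_neg hTρ, if_neg (fun h => hTρ h.1)]; simp
  have hnn : ∀ ρ : RHWave0.riemannZetaNontrivialZeros,
      0 ≤ (if T < |(ρ : ℂ).im| then
          (riemannZetaZeroOrder (ρ : ℂ) : ℝ) * ((x ^ ((ρ : ℂ).re - 1 / 2) + x ^ (-((ρ : ℂ).re - 1 / 2))) / 2) /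
            (ρ : ℂ).im ^ 2 else 0) := by
    intro ρ
    have hx0 : 0 ≤ x := by linarith
    split_ifs
    · exact div_nonneg (mul_nonneg (zeroOrder_nonneg' ρ) (by positivity)) (sq_nonneg _)
    · exact le_rfl
  have hS' : Summable (fun ρ => chargeA x u₁ * tail ρ + phi ρ) := (hStail.mul_left _).add hSphi
  have hS := hS'.of_nonneg_of_le hnn hpt
  have htail_sum : ∑' ρ, tail ρ ≤ (Real.log (T / (2 * π)) + 1) / (π * T) + (184 + 30 * Real.log T) / T ^ 2 :=
    zeroTailBound_tailH hT
  calc _ ≤ ∑' ρ, (chargeA x u₁ * tail ρ + phi ρ) := hS.tsum_le_tsum hpt hS'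
    _ = chargeA x u₁ * ∑' ρ, tail ρ + ∑' ρ, phi ρ := by
        rw [(hStail.mul_left _).tsum_add hSphi, tsum_mul_left]
    _ ≤ chargeA x u₁ * ((Real.log (T / (2 * π)) + 1) / (π * T) + (184 + 30 * Real.log T) / T ^ 2) + cakePhi T x u₁ := by
        have := mul_le_mul_of_nonneg_left htail_sum hA0
        unfold cakePhi
        linarith

/-- **PEEL.**  For cuts `0 ≤ u ≤ v` and `x ≥ 1`: `Φ(u) ≤ (a_x(v) − a_x(u))·M(u) + Φ(v)` — a zero of the layer `u ≤ |β−½| < v`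
has excess `≤ a_x(v) − a_x(u)`; a zero above `v` pays `a_x(v) − a_x(u)` here and its remaining excess in `Φ(v)`. -/
theorem cakePhi_peel {T x u v : ℝ} (hx : 1 ≤ x) (hu : 0 ≤ u) (huv : u ≤ v) :
    cakePhi T x u ≤ (chargeA x v - chargeA x u) * cakeMass T u + cakePhi T x v := by
  have hv : 0 ≤ v := hu.trans huv
  set phiU : RHWave0.riemannZetaNontrivialZeros → ℝ := fun ρ =>
    (if T < |(ρ : ℂ).im| ∧ u ≤ |(ρ : ℂ).re - 1 / 2| then
      (riemannZetaZeroOrder (ρ : ℂ) : ℝ) / (ρ : ℂ).im ^ 2 * (chargeA x ((ρ : ℂ).re - 1 / 2) - chargeA x u) else 0)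
    with hphiU
  set phiV : RHWave0.riemannZetaNontrivialZeros → ℝ := fun ρ =>
    (if T < |(ρ : ℂ).im| ∧ v ≤ |(ρ : ℂ).re - 1 / 2| then
      (riemannZetaZeroOrder (ρ : ℂ) : ℝ) / (ρ : ℂ).im ^ 2 * (chargeA x ((ρ : ℂ).re - 1 / 2) - chargeA x v) else 0)
    with hphiV
  set massU : RHWave0.riemannZetaNontrivialZeros → ℝ := fun ρ =>
    (if T < |(ρ : ℂ).im| ∧ u ≤ |(ρ : ℂ).re - 1 / 2| then (riemannZetaZeroOrder (ρ : ℂ) : ℝ) / (ρ : ℂ).im ^ 2 else 0)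
    with hmassU
  have hSU : Summable phiU := summable_cakePhi hx hu
  have hSV : Summable phiV := summable_cakePhi hx hv
  have hSM : Summable massU := summable_cakeMass T u
  have hcoef : 0 ≤ chargeA x v - chargeA x u := by
    linarith [chargeA_mono hx (show |u| ≤ v by rw [abs_of_nonneg hu]; exact huv)]
  have hpt : ∀ ρ, phiU ρ ≤ (chargeA x v - chargeA x u) * massU ρ + phiV ρ := by
    intro ρ
    simp only [hphiU, hphiV, hmassU]
    have hw : 0 ≤ (riemannZetaZeroOrder (ρ : ℂ) : ℝ) / (ρ : ℂ).im ^ 2 :=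
      div_nonneg (zeroOrder_nonneg' ρ) (sq_nonneg _)
    by_cases hU : T < |(ρ : ℂ).im| ∧ u ≤ |(ρ : ℂ).re - 1 / 2|
    · rw [if_pos hU, if_pos hU]
      by_cases hVc : v ≤ |(ρ : ℂ).re - 1 / 2|
      · rw [if_pos ⟨hU.1, hVc⟩]; nlinarith
      · rw [if_neg (fun h => hVc h.2), add_zero]
        rw [not_le] at hVc
        have hle : chargeA x ((ρ : ℂ).re - 1 / 2) ≤ chargeA x v := chargeA_mono hx hVc.le
        nlinarith
    · rw [if_neg hU, if_neg hU, mul_zero, zero_add]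
      have hV' : ¬ (T < |(ρ : ℂ).im| ∧ v ≤ |(ρ : ℂ).re - 1 / 2|) := fun h => hU ⟨h.1, huv.trans h.2⟩
      rw [if_neg hV']
  have hS' : Summable (fun ρ => (chargeA x v - chargeA x u) * massU ρ + phiV ρ) := (hSM.mul_left _).add hSV
  calc cakePhi T x u = ∑' ρ, phiU ρ := rfl
    _ ≤ ∑' ρ, ((chargeA x v - chargeA x u) * massU ρ + phiV ρ) := hSU.tsum_le_tsum hpt hS'
    _ = (chargeA x v - chargeA x u) * ∑' ρ, massU ρ + ∑' ρ, phiV ρ := by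
        rw [(hSM.mul_left _).tsum_add hSV, tsum_mul_left]
    _ = (chargeA x v - chargeA x u) * cakeMass T u + cakePhi T x v := rfl

/-- **END.**  `Φ(½) = 0`: no non-trivial zero has `|β − ½| ≥ ½` (`0 < β < 1`). -/
theorem cakePhi_half (T x : ℝ) : cakePhi T x (1 / 2) = 0 := by
  unfold cakePhi
  refine (tsum_congr fun ρ => ?_).trans tsum_zero
  have hre0 := ZetaZeros.riemannZetaNontrivialZeros.re_pos ρ.2
  have hre1 := ZetaZeros.riemannZetaNontrivialZeros.re_lt_one ρ.2
  have hlt : |(ρ : ℂ).re - 1 / 2| < 1 / 2 := abs_lt.2 ⟨by linarith, by linarith⟩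
  rw [if_neg (fun h => absurd h.2 (not_le.2 hlt))]

/-- **PEEL, window form.**  With a mass bound `M(u) ≤ M̄` (`0 ≤ M̄`), cuts `0 ≤ u ≤ v` and `1 ≤ x ≤ X`:
`Φ(u) ≤ (X^v − X^u)/2 · M̄ + Φ(v)`. -/
theorem cakePhi_peel_window {T x X u v Mbar : ℝ} (hx : 1 ≤ x) (hxX : x ≤ X) (hu : 0 ≤ u) (huv : u ≤ v)
    (hM : cakeMass T u ≤ Mbar) (hM0 : 0 ≤ Mbar) :
    cakePhi T x u ≤ (X ^ v - X ^ u) / 2 * Mbar + cakePhi T x v := by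
  have h1 := cakePhi_peel (T := T) hx hu huv
  have hcoef : 0 ≤ chargeA x v - chargeA x u := by
    linarith [chargeA_mono hx (show |u| ≤ v by rw [abs_of_nonneg hu]; exact huv)]
  have h2 : (chargeA x v - chargeA x u) * cakeMass T u ≤ (chargeA x v - chargeA x u) * Mbar :=
    mul_le_mul_of_nonneg_left hM hcoef
  have h3 : (chargeA x v - chargeA x u) * Mbar ≤ (X ^ v - X ^ u) / 2 * Mbar :=
    mul_le_mul_of_nonneg_right (chargeA_sub_le hx hxX hu huv) hM0
  linarith

/-- **START, window form.**  For `7 ≤ T`, `1 ≤ x ≤ X`, `0 ≤ u₁`: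
off-line sum `≤ (X^{u₁} + 1)/2 · tailH(T) + Φ(u₁)`. -/
theorem offLine_le_start_window {T x X u₁ : ℝ} (hT : 7 ≤ T) (hx : 1 ≤ x) (hxX : x ≤ X) (hu₁ : 0 ≤ u₁) :
    ∑' ρ : RHWave0.riemannZetaNontrivialZeros,
        (if T < |(ρ : ℂ).im| then
          (riemannZetaZeroOrder (ρ : ℂ) : ℝ) * x ^ ((ρ : ℂ).re - 1 / 2) / (ρ : ℂ).im ^ 2 else 0) ≤
      (X ^ u₁ + 1) / 2 * ((Real.log (T / (2 * π)) + 1) / (π * T) + (184 + 30 * Real.log T) / T ^ 2) + cakePhi T x u₁ := by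
  have h1 := offLine_le_start (T := T) (x := x) hT hx hu₁
  have h2 := mul_le_mul_of_nonneg_right (chargeA_le_window hx hxX hu₁) (tailH_nonneg hT)
  linarith

/-! ### C4 · the class mass by reflection: `M(u) = 2·Σ_{|γ|>T, β ≥ ½+u} m/γ²` for `u > 0` -/

/-- **Class mass from a density tail.**  For `u > 0`, a bound `Σ_{|γ|>T, β ≥ ½+u} m/γ² ≤ S` gives `M_T(u) ≤ 2·S`
(`{|β−½| ≥ u} = {β ≥ ½+u} ⊔ {β ≤ ½−u}`, and `ρ ↦ 1−ρ̄` maps the second class onto the first preserving `m` and `γ`). -/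
theorem cakeMass_le_of_densTail {T u S : ℝ} (hu : 0 < u)
    (hS : ∑' ρ : RHWave0.riemannZetaNontrivialZeros,
        (if T < |(ρ : ℂ).im| ∧ 1 / 2 + u ≤ (ρ : ℂ).re then
          (riemannZetaZeroOrder (ρ : ℂ) : ℝ) / (ρ : ℂ).im ^ 2 else 0) ≤ S) :
    cakeMass T u ≤ 2 * S := by
  set dens : RHWave0.riemannZetaNontrivialZeros → ℝ := fun ρ =>
    if T < |(ρ : ℂ).im| ∧ 1 / 2 + u ≤ (ρ : ℂ).re then (riemannZetaZeroOrder (ρ : ℂ) : ℝ) / (ρ : ℂ).im ^ 2 else 0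
    with hdens
  set densR : RHWave0.riemannZetaNontrivialZeros → ℝ := fun ρ =>
    if T < |(ρ : ℂ).im| ∧ (ρ : ℂ).re ≤ 1 / 2 - u then (riemannZetaZeroOrder (ρ : ℂ) : ℝ) / (ρ : ℂ).im ^ 2 else 0
    with hdensR
  have hStail : Summable (fun ρ : RHWave0.riemannZetaNontrivialZeros =>
      if T < |(ρ : ℂ).im| then (riemannZetaZeroOrder (ρ : ℂ) : ℝ) / (ρ : ℂ).im ^ 2 else 0) := summable_tailTerm T
  have hw : ∀ ρ : RHWave0.riemannZetaNontrivialZeros, 0 ≤ (riemannZetaZeroOrder (ρ : ℂ) : ℝ) / (ρ : ℂ).im ^ 2 :=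
    fun ρ => div_nonneg (zeroOrder_nonneg' ρ) (sq_nonneg _)
  have hdens_nn : ∀ ρ, 0 ≤ dens ρ := fun ρ => by
    simp only [hdens]; split_ifs; exacts [hw ρ, le_rfl]
  have hdensR_nn : ∀ ρ, 0 ≤ densR ρ := fun ρ => by
    simp only [hdensR]; split_ifs; exacts [hw ρ, le_rfl]
  have hdens_le : ∀ ρ, dens ρ ≤ (if T < |(ρ : ℂ).im| then (riemannZetaZeroOrder (ρ : ℂ) : ℝ) / (ρ : ℂ).im ^ 2 else 0) :=
    fun ρ => by
      simp only [hdens]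
      by_cases h1 : T < |(ρ : ℂ).im|
      · by_cases h2 : 1 / 2 + u ≤ (ρ : ℂ).re
        · rw [if_pos ⟨h1, h2⟩, if_pos h1]
        · rw [if_neg (fun h => h2 h.2), if_pos h1]; exact hw ρ
      · rw [if_neg (fun h => h1 h.1), if_neg h1]
  have hdensR_le : ∀ ρ, densR ρ ≤ (if T < |(ρ : ℂ).im| then (riemannZetaZeroOrder (ρ : ℂ) : ℝ) / (ρ : ℂ).im ^ 2 else 0) :=
    fun ρ => by
      simp only [hdensR]
      by_cases h1 : T < |(ρ : ℂ).im|
      · by_cases h2 : (ρ : ℂ).re ≤ 1 / 2 - u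
        · rw [if_pos ⟨h1, h2⟩, if_pos h1]
        · rw [if_neg (fun h => h2 h.2), if_pos h1]; exact hw ρ
      · rw [if_neg (fun h => h1 h.1), if_neg h1]
  have hSdens : Summable dens := hStail.of_nonneg_of_le hdens_nn hdens_le
  have hSdensR : Summable densR := hStail.of_nonneg_of_le hdensR_nn hdensR_le
  have hdens_refl : ∀ ρ, dens (FordL33.refl ρ) = densR ρ := fun ρ => by
    simp only [hdens, hdensR]
    rw [refl_im, FordL33.refl_re, FordL33.order_refl]
    by_cases h1 : T < |(ρ : ℂ).im|
    · by_cases h2 : (ρ : ℂ).re ≤ 1 / 2 - u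
      · have h2' : 1 / 2 + u ≤ 1 - (ρ : ℂ).re := by linarith
        rw [if_pos ⟨h1, h2'⟩, if_pos ⟨h1, h2⟩]
      · have h2' : ¬ 1 / 2 + u ≤ 1 - (ρ : ℂ).re := fun h => h2 (by linarith)
        rw [if_neg (fun h => h2' h.2), if_neg (fun h => h2 h.2)]
    · rw [if_neg (fun h => h1 h.1), if_neg (fun h => h1 h.1)]
  have hdensR_sum_eq : ∑' ρ, densR ρ = ∑' ρ, dens ρ := by
    have h := Equiv.tsum_eq FordL33.reflEquiv dens
    simp only [FordL33.reflEquiv, Function.Involutive.coe_toPerm, hdens_refl] at h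
    exact h
  -- pointwise splitting of the class indicator
  have hpt : ∀ ρ : RHWave0.riemannZetaNontrivialZeros,
      (if T < |(ρ : ℂ).im| ∧ u ≤ |(ρ : ℂ).re - 1 / 2| then (riemannZetaZeroOrder (ρ : ℂ) : ℝ) / (ρ : ℂ).im ^ 2 else 0) =
        dens ρ + densR ρ := by
    intro ρ
    simp only [hdens, hdensR]
    by_cases h1 : T < |(ρ : ℂ).im|
    · by_cases hup : 1 / 2 + u ≤ (ρ : ℂ).re
      · have hdn : ¬ (ρ : ℂ).re ≤ 1 / 2 - u := fun h => by linarith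
        have habs : u ≤ |(ρ : ℂ).re - 1 / 2| := by rw [abs_of_nonneg (by linarith)]; linarith
        rw [if_pos ⟨h1, habs⟩, if_pos ⟨h1, hup⟩, if_neg (fun h => hdn h.2), add_zero]
      · by_cases hdn : (ρ : ℂ).re ≤ 1 / 2 - u
        · have habs : u ≤ |(ρ : ℂ).re - 1 / 2| := by rw [abs_of_nonpos (by linarith)]; linarith
          rw [if_pos ⟨h1, habs⟩, if_neg (fun h => hup h.2), if_pos ⟨h1, hdn⟩, zero_add]
        · have habs : ¬ u ≤ |(ρ : ℂ).re - 1 / 2| := by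
            rw [not_le] at hup hdn
            rw [not_le, abs_lt]; constructor <;> linarith
          rw [if_neg (fun h => habs h.2), if_neg (fun h => hup h.2), if_neg (fun h => hdn h.2), add_zero]
    · rw [if_neg (fun h => h1 h.1), if_neg (fun h => h1 h.1), if_neg (fun h => h1 h.1), add_zero]
  calc cakeMass T u = ∑' ρ, (dens ρ + densR ρ) := by unfold cakeMass; exact tsum_congr hpt
    _ = ∑' ρ, dens ρ + ∑' ρ, densR ρ := hSdens.tsum_add hSdensR
    _ = 2 * ∑' ρ, dens ρ := by rw [hdensR_sum_eq]; ring
    _ ≤ 2 * S := by linarith [hS]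

end CakeB

end Summit.RiemannHypothesis.RiemannHypothesis.Theorems.Splittings.RobinFiniteC1

end
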